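import Mathlib
import Literature.NumberTheory.LFunctions.Zhang2022.Section8Step8u012Prelims
import Literature.NumberTheory.LFunctions.Zhang2022.Section5Lemma52Holds
import Literature.NumberTheory.LFunctions.Zhang2022.Section5Lemma59Ded
import HarnessLib

/-!
# Zhang (2022) §8 p. 43, step `Z22:§8.u012`: "By Lemma 5.2 and 5.9,
# `Ĩ₁⁺(𝐚₁,𝐚₂;ψ) − I₁⁺(𝐚₁,𝐚₂;ψ) ≪ 𝓛⁻¹¹⁴∫_{𝔍(α)}|L(s+β₂,ψ)L(s+β₃,ψ)A(𝐚₁;s,ψ)A(𝐚₂,1−s,ψ̄)ω(s) ds|`"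
# — kernel-checked from Proposition 2.2

Topic `Literature/NumberTheory/LFunctions/Zhang2022` (Landau–Siegel audit tree; verdict-neutral;
D-0069 campaign node **Z22:§8.u012**, locator [Z22 p.43, §8 proof of Lemma 8.1, tex L2240–L2243];
typed claim `Section8aStatements.Step8u012 c′` of L2-t7's `Section8aStatements.lean`).
Y. Zhang, *Discrete mean estimates and the Landau–Siegel zero*, arXiv:2211.02515v1 (2022)
[Zhang2022LandauSiegel] — **an unrefereed manuscript under adjudication**.

`Section8aStatements.step8u012_of_prop22 (hc′ : 0 ≤ c′) : Skeleton.Prop22 c′ → Step8u012 c′` —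
the printed inference with its two inputs supplied by the tree: **Lemma 5.2** is the THEOREM
`Skeleton.lemma52_holds` (`Section5Lemma52Holds`), and **Lemma 5.9** on `𝔍(α)` (heights
`|t − 2πt₀| ≤ 𝓛₁`) is `Skeleton.lemma59_restricted_of_prop22` (`Section5Lemma59Ded`, from
Proposition 2.2). Pointwise on `𝔍(α)` (`s = α + s₀ + iv`, `|v| ≤ 𝓛₁`):
`𝒞̃ − 𝒞 = −i(Y(s+β₁)Y(s+β₂)Y(s+β₃)/Y(s) − (pt₀)^{β₃}Z(s)⁻¹)(L(s+β₁)/L(s))L(s+β₂)L(s+β₃)`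
(`Step8u012Holds.integrandTilde_sub_integrandC`), the first factor is `≤ C₅₂𝓛⁻¹²³|(pt₀)^{β₃}Z(s)⁻¹|`
(Lemma 5.2) with `|(pt₀)^{β₃}Z(s)⁻¹| ≤ e¹¹` (`Step8u012Holds.norm_Zfac_inv_le_exp_of_abs_sub_half_le`),
the second is `≤ C₅₉ log P = C₅₉𝓛⁹` (Lemma 5.9; its hypothesis "`|s − ρ| ≫ α`" holds on `𝔍(α)`
with constant `1` because the zeros in `Ω` are on the line, `Step8u012Holds.alpha_le_norm_sub_of_prop22i`),
whence `≪ 𝓛⁻¹¹⁴|L(s+β₂)L(s+β₃)AAω|`; then `|∫| ≤ ∫|·|` along `𝔍(α)` (both integrands continuous there,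
`Step8u012Holds.continuousOn_integrandTilde_J` / `…C_J`). No new definition, no named fact; the
Assumption (A) antecedent and the (7.2)-admissibility of `𝐚₁, 𝐚₂` in the typed claim are not
used. WHAT THIS IS NOT: any statement about Theorems 1–2 of the manuscript or about Landau–Siegel
zeros; `Prop22` stays a CLAIM node (hypothesis here).

## References

* Y. Zhang, arXiv:2211.02515v1 (2022), §8 p.43 tex L2236–L2243; (7.1); Lemmas 5.2, 5.9;
  Proposition 2.2. [cite: Zhang2022LandauSiegel, §8 p.43]
-/

noncomputable section

open Complex Real Set MeasureTheory intervalIntegral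

namespace Literature.NumberTheory.LFunctions.Zhang2022

namespace Step8u012Holds

open Skeleton Section8aStatements GammaFactor

/-- The scales behind the step, for `𝓛 ≥ 32 + 40c′` (`c′ ≥ 0`): `0 < α ≤ 1/100`, `|b₁|,|b₂|,|b₃| ≤ 1`
(`b_j` the real sizes of the shifts `β_j = ib_j` (2.13)), `t₀ > 0`. [cite: Zhang2022LandauSiegel, §2 (2.13)] -/
theorem scales8 {c' : ℝ} (hc' : 0 ≤ c') {D : ℕ} (hL : 32 + 40 * c' ≤ ell D) :
    0 < alpha D ∧ alpha D ≤ 1 / 100 ∧ |b1 c' D| ≤ 1 ∧ |b2 c' D| ≤ 1 ∧ |b3 c' D| ≤ 1 ∧ 0 < t0 D := by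
  have hlogP : Real.log (bigP D) = ell D ^ 9 := by rw [bigP, Real.log_exp]
  have hα : alpha D = Real.pi / ell D ^ 9 := by rw [alpha, hlogP]
  obtain ⟨hα0, hα100, hcαL⟩ := Lemma59Ded.scales hc' hL hα
  have hL1 : 1 ≤ ell D := by linarith
  have hx0 : 0 ≤ c' * alpha D * ell D := by positivity
  have hp : 0 ≤ alpha D * (c' * alpha D * ell D) := by positivity
  have hp' : alpha D * (c' * alpha D * ell D) ≤ alpha D * (1 / 10) :=
    mul_le_mul_of_nonneg_left hcαL hα0.le
  have e1 : b1 c' D = alpha D - 5 * (alpha D * (c' * alpha D * ell D)) := by rw [b1]; ring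
  have e2 : b2 c' D = 2 * alpha D + 2 * (alpha D * (c' * alpha D * ell D)) := by rw [b2]; ring
  have e3 : b3 c' D = 3 * alpha D - 3 * (alpha D * (c' * alpha D * ell D)) := by rw [b3]; ring
  refine ⟨hα0, hα100, ?_, ?_, ?_, by rw [t0]; positivity⟩
  · rw [e1, abs_le]; constructor <;> linarith
  · rw [e2, abs_le]; constructor <;> linarith
  · rw [e3, abs_le]; constructor <;> linarith

/-- On `𝔍(α)`: `|(pt₀)^{β₃}Z(s,ψ)⁻¹| ≤ e¹¹` for `s = α + s₀ + iv`, `|v| ≤ 𝓛₁`, `𝓛 ≥ 32` (the factor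
of `𝒞(s,ψ)` (7.1) that Lemma 5.2's relative error multiplies; `|(pt₀)^{β₃}| = 1`,
`|Z⁻¹| ≤ exp(α(|log(pt/2π)| + 14/t)) ≤ exp(α(3𝓛⁹ + 4)) ≤ e^{3π+1}`).
[cite: Zhang2022LandauSiegel, §7 (7.1)] -/
theorem norm_coeff_Zinv_le {c' : ℝ} {D : ℕ} (hL : 32 ≤ ell D) (hα0 : 0 < alpha D)
    (hα100 : alpha D ≤ 1 / 100) (x : Chr D) {v : ℝ} (hv : |v| ≤ ell1 D) :
    ‖(((x.p : ℝ) * t0 D : ℝ) : ℂ) ^ beta3 c' D * (Zfac x.ψ ((alpha D : ℂ) + s0 D + v * I))⁻¹‖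
      ≤ Real.exp 11 := by
  have hL1 : 1 ≤ ell D := by linarith
  have ht0pos : 0 < t0 D := by rw [t0]; positivity
  set t : ℝ := 2 * Real.pi * t0 D + v with htdef
  have hs : (alpha D : ℂ) + s0 D + v * I = ((1 / 2 + alpha D : ℝ) : ℂ) + t * I := by
    rw [htdef, s0, SmoothWeight.s0_def]; push_cast; ring
  -- `t ≥ 4` and `|t − 2πt₀| ≤ 𝓛₁ + 1/4`
  have h519 : ell1 D ≤ t0 D := by rw [ell1, t0]; exact pow_le_pow_right₀ hL1 (by norm_num)
  have ht0_32 : 32 ≤ t0 D := by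
    rw [t0]; exact le_trans hL (le_self_pow₀ hL1 (by norm_num))
  have hv' := abs_le.mp hv
  have ht4 : 4 ≤ t := by rw [htdef]; nlinarith [Real.pi_gt_three]
  have htt : |t - 2 * Real.pi * t0 D| ≤ ell1 D + 1 / 4 := by
    rw [htdef, show 2 * Real.pi * t0 D + v - 2 * Real.pi * t0 D = v by ring]; linarith
  have hnorm1 : ‖(((x.p : ℝ) * t0 D : ℝ) : ℂ) ^ beta3 c' D‖ = 1 := norm_cpow_beta3 x ht0pos
  have hZ := norm_Zfac_inv_le_exp_of_abs_sub_half_le x.prim (σ := 1 / 2 + alpha D) (t := t)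
    (by rw [show (1 : ℝ) / 2 + alpha D - 1 / 2 = alpha D by ring, abs_of_pos hα0]; linarith) ht4
  rw [show (1 : ℝ) / 2 + alpha D - 1 / 2 = alpha D by ring, abs_of_pos hα0] at hZ
  -- `|log(pt/2π)| ≤ 3𝓛⁹`
  have hℒ : Real.log x.p + Real.log (|t| + 4) ≤ 3 * ell D ^ 9 := Lemma59Ded.ell_disc_le hL x htt
  have hp0 : (0 : ℝ) < x.p := by exact_mod_cast x.prime.pos
  have hp2 : (2 : ℝ) ≤ x.p := by exact_mod_cast x.prime.two_le
  have ht0' : 0 < t := by linarith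
  have htabs : 0 < |t| + 4 := by linarith [abs_nonneg t]
  have hlog : |Real.log ((x.p : ℝ) * t / (2 * Real.pi))| ≤ 3 * ell D ^ 9 := by
    have hq : 1 ≤ (x.p : ℝ) * t / (2 * Real.pi) := by
      rw [le_div_iff₀ (by positivity)]; nlinarith [Real.pi_lt_four]
    rw [abs_of_nonneg (Real.log_nonneg hq)]
    have hpt0 : 0 < (x.p : ℝ) * t / (2 * Real.pi) := div_pos (mul_pos hp0 ht0') (by positivity)
    have h1 : Real.log ((x.p : ℝ) * t / (2 * Real.pi)) ≤ Real.log ((x.p : ℝ) * (|t| + 4)) := by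
      refine Real.log_le_log hpt0 ?_
      rw [div_le_iff₀ (by positivity)]
      have h3 : (x.p : ℝ) * t ≤ x.p * (|t| + 4) := by nlinarith [le_abs_self t]
      have h4 : (x.p : ℝ) * (|t| + 4) ≤ x.p * (|t| + 4) * (2 * Real.pi) := by
        have h2π : (1 : ℝ) ≤ 2 * Real.pi := by linarith [Real.pi_gt_three]
        have h0 : 0 ≤ (x.p : ℝ) * (|t| + 4) := mul_nonneg hp0.le htabs.le
        exact le_mul_of_one_le_right h0 h2π
      linarith
    rw [Real.log_mul hp0.ne' htabs.ne'] at h1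
    linarith
  have hlogP : Real.log (bigP D) = ell D ^ 9 := by rw [bigP, Real.log_exp]
  have hαL : alpha D * ell D ^ 9 = Real.pi := by
    rw [alpha, hlogP]; field_simp
  have hexp : alpha D * (|Real.log ((x.p : ℝ) * t / (2 * Real.pi))| + 14 / t) ≤ 11 := by
    have h14 : 14 / t ≤ 4 := by rw [div_le_iff₀ (by linarith)]; linarith
    calc alpha D * (|Real.log ((x.p : ℝ) * t / (2 * Real.pi))| + 14 / t)
        ≤ alpha D * (3 * ell D ^ 9 + 4) := by gcongr
      _ = 3 * (alpha D * ell D ^ 9) + 4 * alpha D := by ring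
      _ ≤ 11 := by rw [hαL]; nlinarith [Real.pi_lt_d2]
  rw [norm_mul, hnorm1, one_mul, hs]
  exact hZ.trans (Real.exp_le_exp.mpr hexp)

end Step8u012Holds

namespace Section8aStatements

open Skeleton Step8u012Holds GammaFactor

/-- **`Z22:§8.u012` from Proposition 2.2** ([Z22 p.43, tex L2240–L2243]): for every `c′ ≥ 0`,
`Skeleton.Prop22 c′ → Step8u012 c′` — "By Lemma 5.2 [`Skeleton.lemma52_holds`] and 5.9
[`Skeleton.lemma59_restricted_of_prop22`, on `𝔍(α)` ⊂ heights `≤ 𝓛₁`],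
`|Ĩ₁⁺(𝐚₁,𝐚₂;ψ) − I₁⁺(𝐚₁,𝐚₂;ψ)| ≤ C𝓛⁻¹¹⁴∫_{−𝓛₁}^{𝓛₁}|L(s+β₂,ψ)L(s+β₃,ψ)A(𝐚₁;s,ψ)A(𝐚₂,1−s,ψ̄)ω(s)| dv`",
`s = α + s₀ + iv`, with `C = C₅₂e¹¹C₅₉/(2π)`. [cite: Zhang2022LandauSiegel, §8 p.43, tex L2240–L2243] -/
theorem step8u012_of_prop22 {c' : ℝ} (hc' : 0 ≤ c') (h22 : Prop22 c') : Step8u012 c' := by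
  intro B
  obtain ⟨C₂, D₂, h52⟩ := lemma52_holds c'
  obtain ⟨C₉, D₉, h59⟩ := lemma59_restricted_of_prop22 hc' h22 1 one_pos
  obtain ⟨D₁, hi⟩ := h22.1
  set K : ℝ := max C₂ 0 * Real.exp 11 * max C₉ 0 with hKdef
  have hK0 : 0 ≤ K := by rw [hKdef]; positivity
  refine ⟨K / (2 * Real.pi), max (max D₁ (max D₂ D₉)) ⌈Real.exp (32 + 40 * c')⌉₊,
    fun D _ χ hD hq hp _hA a₁ a₂ _ha₁ _ha₂ x hx => ?_⟩
  -- thresholds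
  have hD₁ : D₁ ≤ D := le_trans (le_trans (le_max_left _ _) (le_max_left _ _)) hD
  have hD₂ : D₂ ≤ D :=
    le_trans (le_trans (le_trans (le_max_left _ _) (le_max_right _ _)) (le_max_left _ _)) hD
  have hD₉ : D₉ ≤ D :=
    le_trans (le_trans (le_trans (le_max_right _ _) (le_max_right _ _)) (le_max_left _ _)) hD
  have hDceil : ⌈Real.exp (32 + 40 * c')⌉₊ ≤ D := le_trans (le_max_right _ _) hD
  have hexp : Real.exp (32 + 40 * c') ≤ D := le_trans (Nat.le_ceil _) (by exact_mod_cast hDceil)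
  have hD0 : (0 : ℝ) < D := lt_of_lt_of_le (Real.exp_pos _) hexp
  have hLc : 32 + 40 * c' ≤ ell D := (Real.le_log_iff_exp_le hD0).mpr hexp
  have hL : 32 ≤ ell D := by linarith
  have hL1 : 1 ≤ ell D := by linarith
  have hLne0 : ell D ≠ 0 := by linarith
  obtain ⟨hα0, hα100, hb1, hb2, hb3, ht0pos⟩ := scales8 hc' hLc
  have hα4 : alpha D ≤ 1 / 4 := by linarith
  have hlogP : Real.log (bigP D) = ell D ^ 9 := by rw [bigP, Real.log_exp]
  have hix := hi D χ hD₁ hq hp x hx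
  have h52x := h52 D χ hD₂ hq hp x
  have h59x := h59 D χ hD₉ hq hp x hx
  -- the points `s = α + s₀ + iv` of `𝔍(α)` and the data there
  have hsv_re : ∀ v : ℝ, ((alpha D : ℂ) + s0 D + v * I).re = 1 / 2 + alpha D := fun v => by
    simp [s0, SmoothWeight.s0_def]; ring
  have hsv_im : ∀ v : ℝ, ((alpha D : ℂ) + s0 D + v * I).im = 2 * π * t0 D + v := fun v => by
    simp [s0, SmoothWeight.s0_def]
  have hfar : ∀ v : ℝ, |v| ≤ ell1 D → ∀ ρ : ℂ, x.ψ.LFunction ρ = 0 →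
      1 * alpha D ≤ ‖((alpha D : ℂ) + s0 D + v * I) - ρ‖ := by
    intro v hv ρ hρ
    rw [one_mul]
    exact alpha_le_norm_sub_of_prop22i χ x hα0.le hα4 hix (hsv_re v)
      (by rw [hsv_im, show 2 * π * t0 D + v - 2 * π * t0 D = v by ring]; exact hv) ρ hρ
  have hLne : ∀ v ∈ Icc (-ell1 D) (ell1 D), x.ψ.LFunction ((alpha D : ℂ) + s0 D + v * I) ≠ 0 := by
    intro v hv h0
    have h := hfar v (abs_le.mpr ⟨hv.1, hv.2⟩) _ h0
    rw [sub_self, norm_zero] at h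
    linarith
  -- pointwise: `‖𝒞̃AAω − 𝒞AAω‖ ≤ K𝓛⁻¹¹⁴‖L(s+β₂)L(s+β₃)AAω‖`
  have hpt : ∀ v ∈ Icc (-ell1 D) (ell1 D),
      ‖integrandTilde c' x a₁ a₂ ((alpha D : ℂ) + s0 D + v * I) -
          integrandC c' x a₁ a₂ ((alpha D : ℂ) + s0 D + v * I)‖ ≤
        K * (ell D ^ 114)⁻¹ *
          ‖x.ψ.LFunction ((alpha D : ℂ) + s0 D + v * I + beta2 c' D) *
              x.ψ.LFunction ((alpha D : ℂ) + s0 D + v * I + beta3 c' D) *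
            Apoly x a₁ ((alpha D : ℂ) + s0 D + v * I) *
              ApolyBar x a₂ (1 - ((alpha D : ℂ) + s0 D + v * I)) *
            omegaW D ((alpha D : ℂ) + s0 D + v * I)‖ := by
    intro v hv
    have hvabs : |v| ≤ ell1 D := abs_le.mpr ⟨hv.1, hv.2⟩
    have hIn : InRange51 D ((alpha D : ℂ) + s0 D + v * I) := by
      refine ⟨?_, ?_⟩
      · rw [hsv_re, show (1 : ℝ) / 2 + alpha D - 1 / 2 = alpha D by ring, abs_of_pos hα0]
      · rw [hsv_im, show 2 * π * t0 D + v - 2 * π * t0 D = v by ring]; linarith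
    -- Lemma 5.2 at `s`
    have h2 := h52x ((alpha D : ℂ) + s0 D + v * I) hIn
    -- Lemma 5.9 at `s`
    have h9 := h59x ((alpha D : ℂ) + s0 D + v * I)
      (by rw [hsv_re, show (1 : ℝ) / 2 + alpha D - 1 / 2 = alpha D by ring, abs_of_pos hα0])
      (by rw [hsv_im, show 2 * π * t0 D + v - 2 * π * t0 D = v by ring]; linarith) (hfar v hvabs)
    have hL0pos : 0 < ‖x.ψ.LFunction ((alpha D : ℂ) + s0 D + v * I)‖ :=
      norm_pos_iff.mpr (hLne v hv)
    rw [norm_div, div_le_iff₀ hL0pos] at h9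
    -- the size of `(pt₀)^{β₃}Z⁻¹`
    have hZ := norm_coeff_Zinv_le (c' := c') hL hα0 hα100 x hvabs
    -- the two factors
    have hYq_le : ‖Yroot x.ψ ((alpha D : ℂ) + s0 D + v * I + beta1 c' D) *
            Yroot x.ψ ((alpha D : ℂ) + s0 D + v * I + beta2 c' D) *
            Yroot x.ψ ((alpha D : ℂ) + s0 D + v * I + beta3 c' D) /
            Yroot x.ψ ((alpha D : ℂ) + s0 D + v * I) -
          (((x.p : ℝ) * t0 D : ℝ) : ℂ) ^ beta3 c' D *
            (Zfac x.ψ ((alpha D : ℂ) + s0 D + v * I))⁻¹‖ ≤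
        max C₂ 0 * (ell D ^ 123)⁻¹ * Real.exp 11 := by
      refine h2.trans ?_
      calc C₂ * (ell D ^ 123)⁻¹ *
            ‖(((x.p : ℝ) * t0 D : ℝ) : ℂ) ^ beta3 c' D * (Zfac x.ψ ((alpha D : ℂ) + s0 D + v * I))⁻¹‖
          ≤ max C₂ 0 * (ell D ^ 123)⁻¹ *
            ‖(((x.p : ℝ) * t0 D : ℝ) : ℂ) ^ beta3 c' D *
              (Zfac x.ψ ((alpha D : ℂ) + s0 D + v * I))⁻¹‖ := by
            gcongr; exact le_max_left _ _
        _ ≤ max C₂ 0 * (ell D ^ 123)⁻¹ * Real.exp 11 := by gcongr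
    have hratio : ‖x.ψ.LFunction ((alpha D : ℂ) + s0 D + v * I + beta1 c' D) /
          x.ψ.LFunction ((alpha D : ℂ) + s0 D + v * I)‖ ≤ max C₉ 0 * ell D ^ 9 := by
      rw [norm_div, div_le_iff₀ hL0pos, ← hlogP]
      refine h9.trans ?_
      have hlog0 : 0 ≤ Real.log (bigP D) := by rw [hlogP]; positivity
      exact mul_le_mul_of_nonneg_right
        (mul_le_mul_of_nonneg_right (le_max_left _ _) hlog0) (norm_nonneg _)
    have hprod : ‖Yroot x.ψ ((alpha D : ℂ) + s0 D + v * I + beta1 c' D) *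
            Yroot x.ψ ((alpha D : ℂ) + s0 D + v * I + beta2 c' D) *
            Yroot x.ψ ((alpha D : ℂ) + s0 D + v * I + beta3 c' D) /
            Yroot x.ψ ((alpha D : ℂ) + s0 D + v * I) -
          (((x.p : ℝ) * t0 D : ℝ) : ℂ) ^ beta3 c' D *
            (Zfac x.ψ ((alpha D : ℂ) + s0 D + v * I))⁻¹‖ *
        ‖x.ψ.LFunction ((alpha D : ℂ) + s0 D + v * I + beta1 c' D) /
          x.ψ.LFunction ((alpha D : ℂ) + s0 D + v * I)‖ ≤ K * (ell D ^ 114)⁻¹ := by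
      refine (mul_le_mul hYq_le hratio (norm_nonneg _) (by positivity)).trans (le_of_eq ?_)
      rw [hKdef]
      field_simp
    rw [integrandTilde_sub_integrandC]
    have e : x.ψ.LFunction ((alpha D : ℂ) + s0 D + v * I + beta2 c' D) *
          x.ψ.LFunction ((alpha D : ℂ) + s0 D + v * I + beta3 c' D) *
        (Apoly x a₁ ((alpha D : ℂ) + s0 D + v * I) *
          ApolyBar x a₂ (1 - ((alpha D : ℂ) + s0 D + v * I)) *
          omegaW D ((alpha D : ℂ) + s0 D + v * I)) =
        x.ψ.LFunction ((alpha D : ℂ) + s0 D + v * I + beta2 c' D) *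
            x.ψ.LFunction ((alpha D : ℂ) + s0 D + v * I + beta3 c' D) *
          Apoly x a₁ ((alpha D : ℂ) + s0 D + v * I) *
            ApolyBar x a₂ (1 - ((alpha D : ℂ) + s0 D + v * I)) *
          omegaW D ((alpha D : ℂ) + s0 D + v * I) := by ring
    rw [← e]
    calc ‖-I *
          (Yroot x.ψ ((alpha D : ℂ) + s0 D + v * I + beta1 c' D) *
                Yroot x.ψ ((alpha D : ℂ) + s0 D + v * I + beta2 c' D) *
                Yroot x.ψ ((alpha D : ℂ) + s0 D + v * I + beta3 c' D) /
                Yroot x.ψ ((alpha D : ℂ) + s0 D + v * I) -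
              (((x.p : ℝ) * t0 D : ℝ) : ℂ) ^ beta3 c' D *
                (Zfac x.ψ ((alpha D : ℂ) + s0 D + v * I))⁻¹) *
          (x.ψ.LFunction ((alpha D : ℂ) + s0 D + v * I + beta1 c' D) /
            x.ψ.LFunction ((alpha D : ℂ) + s0 D + v * I)) *
          (x.ψ.LFunction ((alpha D : ℂ) + s0 D + v * I + beta2 c' D) *
            x.ψ.LFunction ((alpha D : ℂ) + s0 D + v * I + beta3 c' D)) *
          (Apoly x a₁ ((alpha D : ℂ) + s0 D + v * I) *
            ApolyBar x a₂ (1 - ((alpha D : ℂ) + s0 D + v * I)) *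
            omegaW D ((alpha D : ℂ) + s0 D + v * I))‖
        = ‖Yroot x.ψ ((alpha D : ℂ) + s0 D + v * I + beta1 c' D) *
                Yroot x.ψ ((alpha D : ℂ) + s0 D + v * I + beta2 c' D) *
                Yroot x.ψ ((alpha D : ℂ) + s0 D + v * I + beta3 c' D) /
                Yroot x.ψ ((alpha D : ℂ) + s0 D + v * I) -
              (((x.p : ℝ) * t0 D : ℝ) : ℂ) ^ beta3 c' D *
                (Zfac x.ψ ((alpha D : ℂ) + s0 D + v * I))⁻¹‖ *
            ‖x.ψ.LFunction ((alpha D : ℂ) + s0 D + v * I + beta1 c' D) /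
              x.ψ.LFunction ((alpha D : ℂ) + s0 D + v * I)‖ *
            ‖x.ψ.LFunction ((alpha D : ℂ) + s0 D + v * I + beta2 c' D) *
                x.ψ.LFunction ((alpha D : ℂ) + s0 D + v * I + beta3 c' D) *
              (Apoly x a₁ ((alpha D : ℂ) + s0 D + v * I) *
                ApolyBar x a₂ (1 - ((alpha D : ℂ) + s0 D + v * I)) *
                omegaW D ((alpha D : ℂ) + s0 D + v * I))‖ := by
          simp only [norm_mul, norm_neg, Complex.norm_I, one_mul]
          ring
      _ ≤ K * (ell D ^ 114)⁻¹ *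
            ‖x.ψ.LFunction ((alpha D : ℂ) + s0 D + v * I + beta2 c' D) *
                x.ψ.LFunction ((alpha D : ℂ) + s0 D + v * I + beta3 c' D) *
              (Apoly x a₁ ((alpha D : ℂ) + s0 D + v * I) *
                ApolyBar x a₂ (1 - ((alpha D : ℂ) + s0 D + v * I)) *
                omegaW D ((alpha D : ℂ) + s0 D + v * I))‖ :=
          mul_le_mul_of_nonneg_right hprod (norm_nonneg _)
  -- integrability along `𝔍(α)`
  have hℓ0 : (0 : ℝ) ≤ ell1 D := by rw [ell1]; positivity
  have hℓ : (-ell1 D) ≤ ell1 D := by linarith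
  have huIcc : Set.uIcc (-ell1 D) (ell1 D) = Icc (-ell1 D) (ell1 D) := Set.uIcc_of_le hℓ
  have hcontT : ContinuousOn (fun v : ℝ => integrandTilde c' x a₁ a₂ ((alpha D : ℂ) + s0 D + v * I))
      (Icc (-ell1 D) (ell1 D)) :=
    continuousOn_integrandTilde_J x hL1 hb1 hb2 hb3 a₁ a₂ Subset.rfl hLne
  have hcontC : ContinuousOn (fun v : ℝ => integrandC c' x a₁ a₂ ((alpha D : ℂ) + s0 D + v * I))
      (Icc (-ell1 D) (ell1 D)) :=
    continuousOn_integrandC_J x hL1 a₁ a₂ Subset.rfl hLne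
  have hIT : IntervalIntegrable (fun v : ℝ => integrandTilde c' x a₁ a₂ ((alpha D : ℂ) + s0 D + v * I))
      volume (-ell1 D) (ell1 D) :=
    (hcontT.mono (by rw [huIcc])).intervalIntegrable
  have hIC : IntervalIntegrable (fun v : ℝ => integrandC c' x a₁ a₂ ((alpha D : ℂ) + s0 D + v * I))
      volume (-ell1 D) (ell1 D) :=
    (hcontC.mono (by rw [huIcc])).intervalIntegrable
  -- the majorant is continuous (a product of continuous functions)
  have hsvc := continuous_sv D
  have hLc : Continuous x.ψ.LFunction := Ded81Edge.continuous_LFunction_chr x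
  have hmaj : Continuous fun v : ℝ =>
      ‖x.ψ.LFunction ((alpha D : ℂ) + s0 D + v * I + beta2 c' D) *
          x.ψ.LFunction ((alpha D : ℂ) + s0 D + v * I + beta3 c' D) *
        Apoly x a₁ ((alpha D : ℂ) + s0 D + v * I) *
          ApolyBar x a₂ (1 - ((alpha D : ℂ) + s0 D + v * I)) *
        omegaW D ((alpha D : ℂ) + s0 D + v * I)‖ := by
    refine Continuous.norm ?_
    refine Continuous.mul (Continuous.mul (Continuous.mul (Continuous.mul ?_ ?_) ?_) ?_) ?_
    · exact hLc.comp (hsvc.add continuous_const)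
    · exact hLc.comp (hsvc.add continuous_const)
    · exact (Ded81Edge.continuous_dirPoly (Nsupp D) a₁ x.ψ x.p_ne_one).comp hsvc
    · exact (Ded81Edge.continuous_dirPoly (Nsupp D) a₂ x.ψ⁻¹ x.p_ne_one).comp
        (continuous_const.sub hsvc)
    · exact (Ded81Edge.continuous_omega (ell2 D) (t0 D)).comp hsvc
  -- the difference of the two segment integrals
  have hs0 : SmoothWeight.s0 (t0 D) = s0 D := rfl
  have hdiff : Itil c' x (alpha D) a₁ a₂ - IonePlus c' x a₁ a₂ =
      (1 / (2 * π) : ℂ) * ∫ v in (-ell1 D)..ell1 D,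
        (integrandTilde c' x a₁ a₂ ((alpha D : ℂ) + s0 D + v * I) -
          integrandC c' x a₁ a₂ ((alpha D : ℂ) + s0 D + v * I)) := by
    rw [Itil, IonePlus, Lemma81.segInt_def, Lemma81.segInt_def, hs0, ← mul_sub,
      ← intervalIntegral.integral_sub hIT hIC]
  rw [hdiff, norm_mul]
  have hnorm2π : ‖(1 / (2 * π) : ℂ)‖ = 1 / (2 * π) := by
    rw [show (1 / (2 * π) : ℂ) = ((1 / (2 * π) : ℝ) : ℂ) by push_cast; ring, Complex.norm_real,
      Real.norm_eq_abs, abs_of_pos (by positivity)]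
  rw [hnorm2π]
  have hint : ‖∫ v in (-ell1 D)..ell1 D,
        (integrandTilde c' x a₁ a₂ ((alpha D : ℂ) + s0 D + v * I) -
          integrandC c' x a₁ a₂ ((alpha D : ℂ) + s0 D + v * I))‖
      ≤ ∫ v in (-ell1 D)..ell1 D, K * (ell D ^ 114)⁻¹ *
          ‖x.ψ.LFunction ((alpha D : ℂ) + s0 D + v * I + beta2 c' D) *
              x.ψ.LFunction ((alpha D : ℂ) + s0 D + v * I + beta3 c' D) *
            Apoly x a₁ ((alpha D : ℂ) + s0 D + v * I) *
              ApolyBar x a₂ (1 - ((alpha D : ℂ) + s0 D + v * I)) *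
            omegaW D ((alpha D : ℂ) + s0 D + v * I)‖ := by
    refine (intervalIntegral.norm_integral_le_integral_norm hℓ).trans ?_
    exact intervalIntegral.integral_mono_on hℓ (hIT.sub hIC).norm
      ((hmaj.const_mul _).intervalIntegrable _ _) fun v hv => hpt v hv
  rw [intervalIntegral.integral_const_mul] at hint
  have h2π : (0 : ℝ) ≤ 1 / (2 * π) := by positivity
  calc 1 / (2 * π) * ‖∫ v in (-ell1 D)..ell1 D,
          (integrandTilde c' x a₁ a₂ ((alpha D : ℂ) + s0 D + v * I) -
            integrandC c' x a₁ a₂ ((alpha D : ℂ) + s0 D + v * I))‖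
      ≤ 1 / (2 * π) * (K * (ell D ^ 114)⁻¹ * ∫ v in (-ell1 D)..ell1 D,
          ‖x.ψ.LFunction ((alpha D : ℂ) + s0 D + v * I + beta2 c' D) *
              x.ψ.LFunction ((alpha D : ℂ) + s0 D + v * I + beta3 c' D) *
            Apoly x a₁ ((alpha D : ℂ) + s0 D + v * I) *
              ApolyBar x a₂ (1 - ((alpha D : ℂ) + s0 D + v * I)) *
            omegaW D ((alpha D : ℂ) + s0 D + v * I)‖) :=
        mul_le_mul_of_nonneg_left hint h2π
    _ = K / (2 * π) * (ell D ^ 114)⁻¹ * ∫ v in (-ell1 D)..ell1 D,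
          ‖x.ψ.LFunction ((alpha D : ℂ) + s0 D + v * I + beta2 c' D) *
              x.ψ.LFunction ((alpha D : ℂ) + s0 D + v * I + beta3 c' D) *
            Apoly x a₁ ((alpha D : ℂ) + s0 D + v * I) *
              ApolyBar x a₂ (1 - ((alpha D : ℂ) + s0 D + v * I)) *
            omegaW D ((alpha D : ℂ) + s0 D + v * I)‖ := by ring

end Section8aStatements

end Literature.NumberTheory.LFunctions.Zhang2022
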